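import Summits.QuantumFields.YangMills.Theorems.UnitScaleTiltFluctuationComparisonRegPrCertReflectKeyed

/-!
# Route `UnitScaleTilt` — crux `FluctuationComparisonRegPrL` (stmt-QuantumFields-19935), stub `stub_oneStepSmallLift`, piece (L2):
# GENERIC KERNEL-REFLECTION, part 4 — the row-bound fibres of ARBITRARY sparse tables (support file `--supports stmt-QuantumFields-19935`)

Fleet seat `ym-ust-19201-p2` gen 5 (OWNER RULING g20-№9 §3, task «DE-NATIVE CertL3Tree»).  The certified row bound `rowsQ` of `…CertL3Tree` is
a FIBREWISE `ℓ¹` mass over the 3 559-element index `RowIdx ⊕ ChainIdx`; this file computes every fibre ENTRY-DRIVEN for arbitrary tables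
(table functions `KZ` / `EQ` with their push-forward hypotheses `hKZ` / `hEQ`): the (key, coefficient) lists of the four bond rows
(`bondListG`, `bondList0G`) and of the chain boundary (`chainListG`), the class list `rowsListG`, the grouped mass `listMass`, and the identity
«fibre of the decomposed class functional = fibre of `rowsListG`» (`certFiber_piecesG`, over abstract class data: the two exit Booleans, the two
shifted offset functions, the cube-key map with its six face keys).  `…CertL3Tree` instantiates it at `P3` and evaluates `listMass ∘ rowsListG`
by `decide +kernel`.  Table-independent; nothing of Bałaban's.
-/

open scoped BigOperators

namespace Summit.QuantumFields.YangMills.Theorems.ApproxLift.CertReflect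

open Summit.QuantumFields.YangMills.Theorems.ApproxLift

/-- GROUPED `ℓ¹` MASS of a (key, coefficient) list: `Σ_{keys} |Σ_{entries with that key} coefficient|`. -/
def listMass (Λ : List ((ℕ × ℤ × ℤ × ℤ) × ℚ)) : ℚ :=
  ((Λ.map Prod.fst).dedup.map fun kc => |((Λ.filter fun l => l.1 = kc).map Prod.snd).sum|).sum

section Tables

variable {α β : Type*} (fa fp0 fp1 fp2 fo fk0 fk1 fk2 : α → ℕ) (fv : α → ℤ) (gop gq0 gq1 gq2 gm0 gm1 gm2 : β → ℕ) (fv' : β → ℤ)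
  (oi : Orient 3 → ℕ)

/-- ENTRY-DRIVEN (key, coefficient) list of a bond with shifted keys: entries with direction `d`, offsets `q`; key (orientation, `s` + displacement). -/
def bondListG (E : List α) (d : ℕ) (q : Fin 3 → ℕ) (s : Fin 3 → ℤ) (r : ℚ) : List ((ℕ × ℤ × ℤ × ℤ) × ℚ) :=
  (E.filter fun e => fa e = d ∧ fp0 e = q 0 ∧ fp1 e = q 1 ∧ fp2 e = q 2).map fun e =>
    ((fo e, s 0 + ((fk0 e : ℤ) - 2), s 1 + ((fk1 e : ℤ) - 2), s 2 + ((fk2 e : ℤ) - 2)), r * (fv e : ℚ))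

/-- ENTRY-DRIVEN (key, coefficient) list of a bond with unshifted keys. -/
def bondList0G (E : List α) (d : ℕ) (q : Fin 3 → ℕ) (r : ℚ) : List ((ℕ × ℤ × ℤ × ℤ) × ℚ) :=
  (E.filter fun e => fa e = d ∧ fp0 e = q 0 ∧ fp1 e = q 1 ∧ fp2 e = q 2).map fun e =>
    ((fo e, ((fk0 e : ℤ) - 2), ((fk1 e : ℤ) - 2), ((fk2 e : ℤ) - 2)), r * (fv e : ℚ))

/-- ENTRY-DRIVEN (key, coefficient) list of the boundary of a class chain: six faces per cube entry (orientation codes `nA nB nC` of the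
faces normal to directions `0, 1, 2`). -/
def chainListG (E' : List β) (op : ℕ) (pp : Fin 3 → Fin 3) (nA nB nC : ℕ) (r : ℚ) : List ((ℕ × ℤ × ℤ × ℤ) × ℚ) :=
  (E'.filter fun e => gop e = op ∧ gq0 e = (pp 0 : ℕ) ∧ gq1 e = (pp 1 : ℕ) ∧ gq2 e = (pp 2 : ℕ)).flatMap fun e =>
    [((nA, (gm0 e : ℤ) + -2, (gm1 e : ℤ) + -3, (gm2 e : ℤ) + -3), r * (fv' e : ℚ)),
     ((nA, (gm0 e : ℤ) + -3, (gm1 e : ℤ) + -3, (gm2 e : ℤ) + -3), -r * (fv' e : ℚ)),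
     ((nB, (gm0 e : ℤ) + -3, (gm1 e : ℤ) + -2, (gm2 e : ℤ) + -3), -r * (fv' e : ℚ)),
     ((nB, (gm0 e : ℤ) + -3, (gm1 e : ℤ) + -3, (gm2 e : ℤ) + -3), r * (fv' e : ℚ)),
     ((nC, (gm0 e : ℤ) + -3, (gm1 e : ℤ) + -3, (gm2 e : ℤ) + -2), r * (fv' e : ℚ)),
     ((nC, (gm0 e : ℤ) + -3, (gm1 e : ℤ) + -3, (gm2 e : ℤ) + -3), -r * (fv' e : ℚ))]

/-- ENTRY-DRIVEN (key, coefficient) list of a whole class: edge indicator `(uKey, uCoef)`, the four bond rows (directions `μ, ν`; offsets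
`q0` plain, `q1, q2` shifted with block shifts `s1, s2`), the chain boundary (class orientation code `op`). -/
def rowsListG (E : List α) (E' : List β) (uKey : ℕ × ℤ × ℤ × ℤ) (uCoef : ℚ) (μ ν : ℕ) (q0 q1 q2 : Fin 3 → ℕ) (s1 s2 : Fin 3 → ℤ)
    (op : ℕ) (pp : Fin 3 → Fin 3) (nA nB nC : ℕ) (r r' : ℚ) : List ((ℕ × ℤ × ℤ × ℤ) × ℚ) :=
  (uKey, uCoef) ::
    (bondList0G fa fp0 fp1 fp2 fo fk0 fk1 fk2 fv E μ q0 r ++ bondListG fa fp0 fp1 fp2 fo fk0 fk1 fk2 fv E ν q1 s1 r ++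
      bondListG fa fp0 fp1 fp2 fo fk0 fk1 fk2 fv E μ q2 s2 (-r) ++ bondList0G fa fp0 fp1 fp2 fo fk0 fk1 fk2 fv E ν q0 (-r) ++
      chainListG gop gq0 gq1 gq2 gm0 gm1 gm2 fv' E' op pp nA nB nC r')

/-- BOND PIECE (unshifted key, sign `+`). -/
theorem bond_piece0G (hoi : Function.Injective oi) (hos : ∀ n, n < 3 → ∃ o : Orient 3, oi o = n) (E : List α)
    (hE : ∀ e ∈ E, fo e < 3 ∧ fk0 e < 2 * 2 + 1 ∧ fk1 e < 2 * 2 + 1 ∧ fk2 e < 2 * 2 + 1) (c : ℚ)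
    (KZ : Fin 3 → (Fin 3 → Fin 3) → Orient 3 → (Fin 3 → Fin (2 * 2 + 1)) → ℚ)
    (hKZ : ∀ (a : Fin 3) (p : Fin 3 → Fin 3) (o : Orient 3) (k : Fin 3 → Fin (2 * 2 + 1)),
      KZ a p o k = ((E.filter fun e => (fa e == (a : ℕ) && fp0 e == (p 0 : ℕ) && fp1 e == (p 1 : ℕ) && fp2 e == (p 2 : ℕ) && fo e == oi o &&
          fk0 e == (k 0 : ℕ) && fk1 e == (k 1 : ℕ) && fk2 e == (k 2 : ℕ))).map fun e => (fv e : ℚ)).sum / c)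
    (d : Fin 3) (q : Fin 3 → Fin 3) (kc : ℕ × ℤ × ℤ × ℤ) :
    (∑ o : Orient 3, ∑ k : Fin 3 → Fin (2 * 2 + 1), if encKey oi (o, kvec 2 k) = kc then KZ d q o k else 0) =
      (((bondList0G fa fp0 fp1 fp2 fo fk0 fk1 fk2 fv E d (fun i => (q i : ℕ)) c⁻¹).filter fun l => l.1 = kc).map Prod.snd).sum := by
  rw [bondList0G, sum_filter_map_filter]
  simp_rw [hKZ, sum_map_filter, div_eq_inv_mul]
  exact bond_fiber fa fp0 fp1 fp2 fo fk0 fk1 fk2 fv oi hoi hos E hE d q c⁻¹ kc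

/-- BOND PIECE (unshifted key, sign `−`). -/
theorem bond_piece0G_neg (hoi : Function.Injective oi) (hos : ∀ n, n < 3 → ∃ o : Orient 3, oi o = n) (E : List α)
    (hE : ∀ e ∈ E, fo e < 3 ∧ fk0 e < 2 * 2 + 1 ∧ fk1 e < 2 * 2 + 1 ∧ fk2 e < 2 * 2 + 1) (c : ℚ)
    (KZ : Fin 3 → (Fin 3 → Fin 3) → Orient 3 → (Fin 3 → Fin (2 * 2 + 1)) → ℚ)
    (hKZ : ∀ (a : Fin 3) (p : Fin 3 → Fin 3) (o : Orient 3) (k : Fin 3 → Fin (2 * 2 + 1)),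
      KZ a p o k = ((E.filter fun e => (fa e == (a : ℕ) && fp0 e == (p 0 : ℕ) && fp1 e == (p 1 : ℕ) && fp2 e == (p 2 : ℕ) && fo e == oi o &&
          fk0 e == (k 0 : ℕ) && fk1 e == (k 1 : ℕ) && fk2 e == (k 2 : ℕ))).map fun e => (fv e : ℚ)).sum / c)
    (d : Fin 3) (q : Fin 3 → Fin 3) (kc : ℕ × ℤ × ℤ × ℤ) :
    (∑ o : Orient 3, ∑ k : Fin 3 → Fin (2 * 2 + 1), if encKey oi (o, kvec 2 k) = kc then -KZ d q o k else 0) =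
      (((bondList0G fa fp0 fp1 fp2 fo fk0 fk1 fk2 fv E d (fun i => (q i : ℕ)) (-c⁻¹)).filter fun l => l.1 = kc).map Prod.snd).sum := by
  rw [bondList0G, sum_filter_map_filter]
  simp_rw [hKZ, sum_map_filter, div_eq_inv_mul, ← neg_mul]
  exact bond_fiber fa fp0 fp1 fp2 fo fk0 fk1 fk2 fv oi hoi hos E hE d q (-c⁻¹) kc

/-- BOND PIECE (shifted key, sign `+`). -/
theorem bond_pieceG (hoi : Function.Injective oi) (hos : ∀ n, n < 3 → ∃ o : Orient 3, oi o = n) (E : List α)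
    (hE : ∀ e ∈ E, fo e < 3 ∧ fk0 e < 2 * 2 + 1 ∧ fk1 e < 2 * 2 + 1 ∧ fk2 e < 2 * 2 + 1) (c : ℚ)
    (KZ : Fin 3 → (Fin 3 → Fin 3) → Orient 3 → (Fin 3 → Fin (2 * 2 + 1)) → ℚ)
    (hKZ : ∀ (a : Fin 3) (p : Fin 3 → Fin 3) (o : Orient 3) (k : Fin 3 → Fin (2 * 2 + 1)),
      KZ a p o k = ((E.filter fun e => (fa e == (a : ℕ) && fp0 e == (p 0 : ℕ) && fp1 e == (p 1 : ℕ) && fp2 e == (p 2 : ℕ) && fo e == oi o &&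
          fk0 e == (k 0 : ℕ) && fk1 e == (k 1 : ℕ) && fk2 e == (k 2 : ℕ))).map fun e => (fv e : ℚ)).sum / c)
    (d : Fin 3) (q : Fin 3 → Fin 3) (s : Fin 3 → ℤ) (kc : ℕ × ℤ × ℤ × ℤ) :
    (∑ o : Orient 3, ∑ k : Fin 3 → Fin (2 * 2 + 1), if encKey oi (o, s + kvec 2 k) = kc then KZ d q o k else 0) =
      (((bondListG fa fp0 fp1 fp2 fo fk0 fk1 fk2 fv E d (fun i => (q i : ℕ)) s c⁻¹).filter fun l => l.1 = kc).map Prod.snd).sum := by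
  rw [bondListG, sum_filter_map_filter]
  simp_rw [hKZ, sum_map_filter, div_eq_inv_mul]
  exact bond_fiber_shift fa fp0 fp1 fp2 fo fk0 fk1 fk2 fv oi hoi hos E hE d q s c⁻¹ kc

/-- BOND PIECE (shifted key, sign `−`). -/
theorem bond_pieceG_neg (hoi : Function.Injective oi) (hos : ∀ n, n < 3 → ∃ o : Orient 3, oi o = n) (E : List α)
    (hE : ∀ e ∈ E, fo e < 3 ∧ fk0 e < 2 * 2 + 1 ∧ fk1 e < 2 * 2 + 1 ∧ fk2 e < 2 * 2 + 1) (c : ℚ)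
    (KZ : Fin 3 → (Fin 3 → Fin 3) → Orient 3 → (Fin 3 → Fin (2 * 2 + 1)) → ℚ)
    (hKZ : ∀ (a : Fin 3) (p : Fin 3 → Fin 3) (o : Orient 3) (k : Fin 3 → Fin (2 * 2 + 1)),
      KZ a p o k = ((E.filter fun e => (fa e == (a : ℕ) && fp0 e == (p 0 : ℕ) && fp1 e == (p 1 : ℕ) && fp2 e == (p 2 : ℕ) && fo e == oi o &&
          fk0 e == (k 0 : ℕ) && fk1 e == (k 1 : ℕ) && fk2 e == (k 2 : ℕ))).map fun e => (fv e : ℚ)).sum / c)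
    (d : Fin 3) (q : Fin 3 → Fin 3) (s : Fin 3 → ℤ) (kc : ℕ × ℤ × ℤ × ℤ) :
    (∑ o : Orient 3, ∑ k : Fin 3 → Fin (2 * 2 + 1), if encKey oi (o, s + kvec 2 k) = kc then -KZ d q o k else 0) =
      (((bondListG fa fp0 fp1 fp2 fo fk0 fk1 fk2 fv E d (fun i => (q i : ℕ)) s (-c⁻¹)).filter fun l => l.1 = kc).map Prod.snd).sum := by
  rw [bondListG, sum_filter_map_filter]
  simp_rw [hKZ, sum_map_filter, div_eq_inv_mul, ← neg_mul]
  exact bond_fiber_shift fa fp0 fp1 fp2 fo fk0 fk1 fk2 fv oi hoi hos E hE d q s (-c⁻¹) kc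

/-- CHAIN FACE: the cube sum of one face shape collapses, entry by entry, onto the decoded cube. -/
theorem chain_faceG (E' : List β) (hE' : ∀ e ∈ E', gm0 e < 2 * (2 + 1) + 1 ∧ gm1 e < 2 * (2 + 1) + 1 ∧ gm2 e < 2 * (2 + 1) + 1)
    (μ ν : Fin 3) (h : μ < ν) (pp : Fin 3 → Fin 3) (kc : ℕ × ℤ × ℤ × ℤ) (r : ℚ) (n : ℕ) (c0 c1 c2 : ℤ) :
    (E'.map fun e => ∑ q : Fin 3 → Fin (2 * (2 + 1) + 1),
        if (gop e == oi ⟨(μ, ν), h⟩ && gq0 e == (pp 0 : ℕ) && gq1 e == (pp 1 : ℕ) && gq2 e == (pp 2 : ℕ) &&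
          gm0 e == (q 0 : ℕ) && gm1 e == (q 1 : ℕ) && gm2 e == (q 2 : ℕ)) = true then
          (if ((n, ((q 0 : ℕ) : ℤ) + c0, ((q 1 : ℕ) : ℤ) + c1, ((q 2 : ℕ) : ℤ) + c2) : ℕ × ℤ × ℤ × ℤ) = kc then r * (fv' e : ℚ) else 0)
        else 0).sum =
      (E'.map fun e => if gop e = oi ⟨(μ, ν), h⟩ ∧ gq0 e = (pp 0 : ℕ) ∧ gq1 e = (pp 1 : ℕ) ∧ gq2 e = (pp 2 : ℕ) then
          (if ((n, (gm0 e : ℤ) + c0, (gm1 e : ℤ) + c1, (gm2 e : ℤ) + c2) : ℕ × ℤ × ℤ × ℤ) = kc then r * (fv' e : ℚ) else 0)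
        else 0).sum := by
  refine congrArg List.sum (List.map_congr_left fun e he => ?_)
  obtain ⟨hm0, hm1, hm2⟩ := hE' e he
  obtain ⟨q₀, e0, e1, e2⟩ := exists_vec3 _ _ _ hm0 hm1 hm2
  rw [collapseE gop gq0 gq1 gq2 gm0 gm1 gm2 oi e
    (fun q => if ((n, ((q 0 : ℕ) : ℤ) + c0, ((q 1 : ℕ) : ℤ) + c1, ((q 2 : ℕ) : ℤ) + c2) : ℕ × ℤ × ℤ × ℤ) = kc then r * (fv' e : ℚ) else 0)
    μ ν h pp q₀ e0 e1 e2]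
  simp only [← e0, ← e1, ← e2]

/-- CHAIN PIECE, GENERIC: for an abstract cube-key map `CK` whose six faces on `(0,1,2)` have the displayed encoded keys (orientation codes
`nA nB nC`), the boundary of the class chain is the fibre of `chainListG`. -/
theorem chain_pieceG (E' : List β) (hE' : ∀ e ∈ E', gm0 e < 2 * (2 + 1) + 1 ∧ gm1 e < 2 * (2 + 1) + 1 ∧ gm2 e < 2 * (2 + 1) + 1) (c' : ℚ)
    (EQ : ∀ μ ν : Fin 3, μ < ν → (Fin 3 → Fin 3) → Tri 3 → (Fin 3 → Fin (2 * (2 + 1) + 1)) → ℚ)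
    (hEQ : ∀ (μ ν : Fin 3) (h : μ < ν) (pp : Fin 3 → Fin 3) (τ : Tri 3) (q : Fin 3 → Fin (2 * (2 + 1) + 1)),
      EQ μ ν h pp τ q = ((E'.filter fun e => (gop e == oi ⟨(μ, ν), h⟩ && gq0 e == (pp 0 : ℕ) && gq1 e == (pp 1 : ℕ) && gq2 e == (pp 2 : ℕ) &&
          gm0 e == (q 0 : ℕ) && gm1 e == (q 1 : ℕ) && gm2 e == (q 2 : ℕ))).map fun e => (fv' e : ℚ)).sum / c')
    (CK : (Tri 3 × (Fin 3 → Fin (2 * (2 + 1) + 1))) × Fin 6 → Key 3) (nA nB nC : ℕ)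
    (hCK : ∀ q : Fin 3 → Fin (2 * (2 + 1) + 1),
      encKey oi (CK (((⟨(0, 1, 2), by decide, by decide⟩ : Tri 3), q), 0)) = (nA, ((q 0 : ℕ) : ℤ) + -2, ((q 1 : ℕ) : ℤ) + -3, ((q 2 : ℕ) : ℤ) + -3) ∧
      encKey oi (CK (((⟨(0, 1, 2), by decide, by decide⟩ : Tri 3), q), 1)) = (nA, ((q 0 : ℕ) : ℤ) + -3, ((q 1 : ℕ) : ℤ) + -3, ((q 2 : ℕ) : ℤ) + -3) ∧
      encKey oi (CK (((⟨(0, 1, 2), by decide, by decide⟩ : Tri 3), q), 2)) = (nB, ((q 0 : ℕ) : ℤ) + -3, ((q 1 : ℕ) : ℤ) + -2, ((q 2 : ℕ) : ℤ) + -3) ∧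
      encKey oi (CK (((⟨(0, 1, 2), by decide, by decide⟩ : Tri 3), q), 3)) = (nB, ((q 0 : ℕ) : ℤ) + -3, ((q 1 : ℕ) : ℤ) + -3, ((q 2 : ℕ) : ℤ) + -3) ∧
      encKey oi (CK (((⟨(0, 1, 2), by decide, by decide⟩ : Tri 3), q), 4)) = (nC, ((q 0 : ℕ) : ℤ) + -3, ((q 1 : ℕ) : ℤ) + -3, ((q 2 : ℕ) : ℤ) + -2) ∧
      encKey oi (CK (((⟨(0, 1, 2), by decide, by decide⟩ : Tri 3), q), 5)) = (nC, ((q 0 : ℕ) : ℤ) + -3, ((q 1 : ℕ) : ℤ) + -3, ((q 2 : ℕ) : ℤ) + -3))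
    (μ ν : Fin 3) (h : μ < ν) (pp : Fin 3 → Fin 3) (kc : ℕ × ℤ × ℤ × ℤ) :
    (∑ q : Fin 3 → Fin (2 * (2 + 1) + 1), ∑ f : Fin 6,
        if encKey oi (CK (((⟨(0, 1, 2), by decide, by decide⟩ : Tri 3), q), f)) = kc then
          (if f = 0 then EQ μ ν h pp (⟨(0, 1, 2), by decide, by decide⟩ : Tri 3) q
            else if f = 1 then -EQ μ ν h pp (⟨(0, 1, 2), by decide, by decide⟩ : Tri 3) q
            else if f = 2 then -EQ μ ν h pp (⟨(0, 1, 2), by decide, by decide⟩ : Tri 3) q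
            else if f = 3 then EQ μ ν h pp (⟨(0, 1, 2), by decide, by decide⟩ : Tri 3) q
            else if f = 4 then EQ μ ν h pp (⟨(0, 1, 2), by decide, by decide⟩ : Tri 3) q
            else -EQ μ ν h pp (⟨(0, 1, 2), by decide, by decide⟩ : Tri 3) q)
        else 0) =
      (((chainListG gop gq0 gq1 gq2 gm0 gm1 gm2 fv' E' (oi ⟨(μ, ν), h⟩) pp nA nB nC c'⁻¹).filter fun l => l.1 = kc).map Prod.snd).sum := by
  have hk0 : ∀ q, encKey oi (CK (((⟨(0, 1, 2), by decide, by decide⟩ : Tri 3), q), 0)) = (nA, ((q 0 : ℕ) : ℤ) + -2, ((q 1 : ℕ) : ℤ) + -3, ((q 2 : ℕ) : ℤ) + -3) :=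
    fun q => (hCK q).1
  have hk1 : ∀ q, encKey oi (CK (((⟨(0, 1, 2), by decide, by decide⟩ : Tri 3), q), 1)) = (nA, ((q 0 : ℕ) : ℤ) + -3, ((q 1 : ℕ) : ℤ) + -3, ((q 2 : ℕ) : ℤ) + -3) :=
    fun q => (hCK q).2.1
  have hk2 : ∀ q, encKey oi (CK (((⟨(0, 1, 2), by decide, by decide⟩ : Tri 3), q), 2)) = (nB, ((q 0 : ℕ) : ℤ) + -3, ((q 1 : ℕ) : ℤ) + -2, ((q 2 : ℕ) : ℤ) + -3) :=
    fun q => (hCK q).2.2.1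
  have hk3 : ∀ q, encKey oi (CK (((⟨(0, 1, 2), by decide, by decide⟩ : Tri 3), q), 3)) = (nB, ((q 0 : ℕ) : ℤ) + -3, ((q 1 : ℕ) : ℤ) + -3, ((q 2 : ℕ) : ℤ) + -3) :=
    fun q => (hCK q).2.2.2.1
  have hk4 : ∀ q, encKey oi (CK (((⟨(0, 1, 2), by decide, by decide⟩ : Tri 3), q), 4)) = (nC, ((q 0 : ℕ) : ℤ) + -3, ((q 1 : ℕ) : ℤ) + -3, ((q 2 : ℕ) : ℤ) + -2) :=
    fun q => (hCK q).2.2.2.2.1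
  have hk5 : ∀ q, encKey oi (CK (((⟨(0, 1, 2), by decide, by decide⟩ : Tri 3), q), 5)) = (nC, ((q 0 : ℕ) : ℤ) + -3, ((q 1 : ℕ) : ℤ) + -3, ((q 2 : ℕ) : ℤ) + -3) :=
    fun q => (hCK q).2.2.2.2.2
  rw [chainListG, sum_filter_flatMap_filter]
  simp only [sum_filter_snd_cons, List.filter_nil, List.map_nil, List.sum_nil, add_zero, sum_map_ite_add]
  simp only [Fin.sum_univ_six, Fin.isValue, if_true, if_false, show (1 : Fin 6) ≠ 0 by decide, show (2 : Fin 6) ≠ 0 by decide, show (2 : Fin 6) ≠ 1 by decide,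
    show (3 : Fin 6) ≠ 0 by decide, show (3 : Fin 6) ≠ 1 by decide, show (3 : Fin 6) ≠ 2 by decide, show (4 : Fin 6) ≠ 0 by decide,
    show (4 : Fin 6) ≠ 1 by decide, show (4 : Fin 6) ≠ 2 by decide, show (4 : Fin 6) ≠ 3 by decide, show (5 : Fin 6) ≠ 0 by decide,
    show (5 : Fin 6) ≠ 1 by decide, show (5 : Fin 6) ≠ 2 by decide, show (5 : Fin 6) ≠ 3 by decide, show (5 : Fin 6) ≠ 4 by decide,
    hk0, hk1, hk2, hk3, hk4, hk5, Finset.sum_add_distrib]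
  simp_rw [hEQ, sum_map_filter, div_eq_inv_mul, ← neg_mul, ite_mul_sum_map, finset_sum_list_sum]
  rw [chain_faceG gop gq0 gq1 gq2 gm0 gm1 gm2 fv' oi E' hE' μ ν h pp kc (c'⁻¹) nA (-2) (-3) (-3),
    chain_faceG gop gq0 gq1 gq2 gm0 gm1 gm2 fv' oi E' hE' μ ν h pp kc (-c'⁻¹) nA (-3) (-3) (-3),
    chain_faceG gop gq0 gq1 gq2 gm0 gm1 gm2 fv' oi E' hE' μ ν h pp kc (-c'⁻¹) nB (-3) (-2) (-3),
    chain_faceG gop gq0 gq1 gq2 gm0 gm1 gm2 fv' oi E' hE' μ ν h pp kc (c'⁻¹) nB (-3) (-3) (-3),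
    chain_faceG gop gq0 gq1 gq2 gm0 gm1 gm2 fv' oi E' hE' μ ν h pp kc (c'⁻¹) nC (-3) (-3) (-2),
    chain_faceG gop gq0 gq1 gq2 gm0 gm1 gm2 fv' oi E' hE' μ ν h pp kc (-c'⁻¹) nC (-3) (-3) (-3)]
  simp only [add_assoc]

/-- **THE CLASS FIBRE, PIECE BY PIECE (GENERIC)**: edge indicator + four bond rows + chain boundary (the shape the decomposed class functional
of `…CertL3Tree` takes after unfolding, over abstract class data `exμ exν q1 q2 CK`) = the fibre of `rowsListG`. -/
theorem certFiber_piecesG (hoi : Function.Injective oi) (hos : ∀ n, n < 3 → ∃ o : Orient 3, oi o = n) (E : List α)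
    (hE : ∀ e ∈ E, fo e < 3 ∧ fk0 e < 2 * 2 + 1 ∧ fk1 e < 2 * 2 + 1 ∧ fk2 e < 2 * 2 + 1) (c : ℚ)
    (KZ : Fin 3 → (Fin 3 → Fin 3) → Orient 3 → (Fin 3 → Fin (2 * 2 + 1)) → ℚ)
    (hKZ : ∀ (a : Fin 3) (p : Fin 3 → Fin 3) (o : Orient 3) (k : Fin 3 → Fin (2 * 2 + 1)),
      KZ a p o k = ((E.filter fun e => (fa e == (a : ℕ) && fp0 e == (p 0 : ℕ) && fp1 e == (p 1 : ℕ) && fp2 e == (p 2 : ℕ) && fo e == oi o &&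
          fk0 e == (k 0 : ℕ) && fk1 e == (k 1 : ℕ) && fk2 e == (k 2 : ℕ))).map fun e => (fv e : ℚ)).sum / c)
    (E' : List β) (hE' : ∀ e ∈ E', gm0 e < 2 * (2 + 1) + 1 ∧ gm1 e < 2 * (2 + 1) + 1 ∧ gm2 e < 2 * (2 + 1) + 1) (c' : ℚ)
    (EQ : ∀ μ ν : Fin 3, μ < ν → (Fin 3 → Fin 3) → Tri 3 → (Fin 3 → Fin (2 * (2 + 1) + 1)) → ℚ)
    (hEQ : ∀ (μ ν : Fin 3) (h : μ < ν) (pp : Fin 3 → Fin 3) (τ : Tri 3) (q : Fin 3 → Fin (2 * (2 + 1) + 1)),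
      EQ μ ν h pp τ q = ((E'.filter fun e => (gop e == oi ⟨(μ, ν), h⟩ && gq0 e == (pp 0 : ℕ) && gq1 e == (pp 1 : ℕ) && gq2 e == (pp 2 : ℕ) &&
          gm0 e == (q 0 : ℕ) && gm1 e == (q 1 : ℕ) && gm2 e == (q 2 : ℕ))).map fun e => (fv' e : ℚ)).sum / c')
    (CK : (Tri 3 × (Fin 3 → Fin (2 * (2 + 1) + 1))) × Fin 6 → Key 3) (nA nB nC : ℕ)
    (hCK : ∀ q : Fin 3 → Fin (2 * (2 + 1) + 1),
      encKey oi (CK (((⟨(0, 1, 2), by decide, by decide⟩ : Tri 3), q), 0)) = (nA, ((q 0 : ℕ) : ℤ) + -2, ((q 1 : ℕ) : ℤ) + -3, ((q 2 : ℕ) : ℤ) + -3) ∧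
      encKey oi (CK (((⟨(0, 1, 2), by decide, by decide⟩ : Tri 3), q), 1)) = (nA, ((q 0 : ℕ) : ℤ) + -3, ((q 1 : ℕ) : ℤ) + -3, ((q 2 : ℕ) : ℤ) + -3) ∧
      encKey oi (CK (((⟨(0, 1, 2), by decide, by decide⟩ : Tri 3), q), 2)) = (nB, ((q 0 : ℕ) : ℤ) + -3, ((q 1 : ℕ) : ℤ) + -2, ((q 2 : ℕ) : ℤ) + -3) ∧
      encKey oi (CK (((⟨(0, 1, 2), by decide, by decide⟩ : Tri 3), q), 3)) = (nB, ((q 0 : ℕ) : ℤ) + -3, ((q 1 : ℕ) : ℤ) + -3, ((q 2 : ℕ) : ℤ) + -3) ∧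
      encKey oi (CK (((⟨(0, 1, 2), by decide, by decide⟩ : Tri 3), q), 4)) = (nC, ((q 0 : ℕ) : ℤ) + -3, ((q 1 : ℕ) : ℤ) + -3, ((q 2 : ℕ) : ℤ) + -2) ∧
      encKey oi (CK (((⟨(0, 1, 2), by decide, by decide⟩ : Tri 3), q), 5)) = (nC, ((q 0 : ℕ) : ℤ) + -3, ((q 1 : ℕ) : ℤ) + -3, ((q 2 : ℕ) : ℤ) + -3))
    (exμ exν : Bool) (q1 q2 : Fin 3 → Fin 3) (μ ν : Fin 3) (h : μ < ν) (pp : Fin 3 → Fin 3) (kc : ℕ × ℤ × ℤ × ℤ) :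
    (if encKey oi ((⟨(μ, ν), h⟩ : Orient 3), (0 : Fin 3 → ℤ)) = kc then (if exμ = true ∧ exν = true then (1 : ℚ) else 0) else 0) +
      ((((∑ o : Orient 3, ∑ k : Fin 3 → Fin (2 * 2 + 1), if encKey oi (o, kvec 2 k) = kc then KZ μ pp o k else 0) +
          (∑ o : Orient 3, ∑ k : Fin 3 → Fin (2 * 2 + 1), if encKey oi (o, bvec exμ μ + kvec 2 k) = kc then KZ ν q1 o k else 0)) +
        (∑ o : Orient 3, ∑ k : Fin 3 → Fin (2 * 2 + 1), if encKey oi (o, bvec exν ν + kvec 2 k) = kc then -KZ μ q2 o k else 0)) +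
        (∑ o : Orient 3, ∑ k : Fin 3 → Fin (2 * 2 + 1), if encKey oi (o, kvec 2 k) = kc then -KZ ν pp o k else 0)) +
      (∑ τ : Tri 3, ∑ q : Fin 3 → Fin (2 * (2 + 1) + 1), ∑ f : Fin 6,
        if encKey oi (CK ((τ, q), f)) = kc then
          (if f = 0 then EQ μ ν h pp τ q else if f = 1 then -EQ μ ν h pp τ q else if f = 2 then -EQ μ ν h pp τ q
            else if f = 3 then EQ μ ν h pp τ q else if f = 4 then EQ μ ν h pp τ q else -EQ μ ν h pp τ q)
        else 0) =
    (((rowsListG fa fp0 fp1 fp2 fo fk0 fk1 fk2 fv gop gq0 gq1 gq2 gm0 gm1 gm2 fv' E E'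
        (encKey oi ((⟨(μ, ν), h⟩ : Orient 3), (0 : Fin 3 → ℤ))) (if exμ = true ∧ exν = true then (1 : ℚ) else 0)
        μ ν (fun i => (pp i : ℕ)) (fun i => (q1 i : ℕ)) (fun i => (q2 i : ℕ)) (bvec exμ μ) (bvec exν ν)
        (oi ⟨(μ, ν), h⟩) pp nA nB nC c⁻¹ c'⁻¹).filter fun l => l.1 = kc).map Prod.snd).sum := by
  rw [sum_tri3, bond_piece0G fa fp0 fp1 fp2 fo fk0 fk1 fk2 fv oi hoi hos E hE c KZ hKZ μ pp kc,
    bond_pieceG fa fp0 fp1 fp2 fo fk0 fk1 fk2 fv oi hoi hos E hE c KZ hKZ ν q1 (bvec exμ μ) kc,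
    bond_pieceG_neg fa fp0 fp1 fp2 fo fk0 fk1 fk2 fv oi hoi hos E hE c KZ hKZ μ q2 (bvec exν ν) kc,
    bond_piece0G_neg fa fp0 fp1 fp2 fo fk0 fk1 fk2 fv oi hoi hos E hE c KZ hKZ ν pp kc,
    chain_pieceG gop gq0 gq1 gq2 gm0 gm1 gm2 fv' oi E' hE' c' EQ hEQ CK nA nB nC hCK μ ν h pp kc,
    rowsListG, sum_filter_snd_cons]
  simp only [sum_filter_snd_append]
  ring

end Tables

end Summit.QuantumFields.YangMills.Theorems.ApproxLift.CertReflect
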